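import Literature.AlgebraicGeometry.ComplexMultiplication.ShimuraInflationBettiJunctions
import Literature.AlgebraicGeometry.HodgeTheory.BettiUniverseAxioms
import HarnessLib

/-!
# `H¹` of a split complex abelian variety, and block-diagonal bijectivity of a pull-back

Topic `Literature/AlgebraicGeometry/HodgeTheory`, namespace `Literature.AlgebraicGeometry.HodgeTheory`.  Cell `hodgecm-mathlib`
(D-0151), row III-0 (Liu 2021 Lemma 2.4 (1)), the (G)-road (A-p18 lead), piece F6 — the PURELY FORMAL half of the «Liu glue»:

* `bijective_pi_pull_of_split` — if a complex abelian variety `A` is SPLIT by homomorphisms `π_c : A → J_c`, `ι_c : J_c → A`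
  (`ι_c ≫ π_c = 𝟙`, `ι_c ≫ π_{c′} = 0` for `c ≠ c′`, `Σ_c π_c ≫ ι_c = 𝟙`; e.g. a limit fan / biproduct), then
  `ξ ↦ (ι_c^* ξ)_c : H¹(A(ℂ); ℚ) → Π_c H¹(J_c(ℂ); ℚ)` is bijective, with inverse `(η_c) ↦ Σ_c π_c^* η_c` — homomorphisms act
  additively on `H¹` (`ComplexMultiplication.bettiCohomology_map_add_one / _sum_one / _zero_one`; Mumford §1, Lange–Birkenhake 1.1);
* `bijective_pull_of_split_factorisation` — **block-diagonal bijectivity**: if moreover `f_c : E_c → X` are complex schemes over `X` with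
  `ξ ↦ (f_c^* ξ)_c` bijective on `H¹` (e.g. a coproduct cofan, `BettiCofan.bijective_pi_pull`), `g_c : E_c → J_c` have `g_c^*` bijective
  on `H¹`, and `αx : X → A` FACTORS piecewise as `f_c ≫ αx = g_c ≫ ι_c`, then `αx^* : H¹(A(ℂ); ℚ) → H¹(X(ℂ); ℚ)` is bijective: under the
  two identifications it is the diagonal map `(η_c) ↦ (g_c^* η_c)`.

This is how Lemma 2.4 (1) («`(α_X)_x^* : H¹(Alb_X ⊗ ℂ) ≅ H¹(X ⊗ ℂ)`») follows from an α-compatible finite-Galois Albanese fan: `J_c` the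
complexified Albanese varieties of the pieces, `g_c` their Abel–Jacobi maps.  Theorems only, Mathlib-level linear algebra over the tree's
`H¹`-additivity; no definition, no named fact.  HC_CM is proved only modulo the 7 printed citations until rung 0 closes.

## References
* [MumfordAV1970] D. Mumford, *Abelian Varieties* (1970), §1 (1)–(3) (`H¹` of a complex torus, additivity), §19 (products).
* [Liu2021] Y. Liu, arXiv:2102.11518 = Camb. J. Math. 9 (2021), Lemma 2.4 (1) (proof, l. 1220–1228).
-/

noncomputable section

open CategoryTheory CategoryTheory.Limits

namespace Literature.AlgebraicGeometry.HodgeTheory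

open Literature.AlgebraicGeometry.Motives (SchemeOver AbelianVariety bettiCohomology)
open Literature.AlgebraicGeometry.ComplexMultiplication (bettiCohomology_map_add_one bettiCohomology_map_sum_one
  bettiCohomology_map_zero_one bettiCohomology_map_id_hom bettiCohomology_map_comp_hom)

section Split

variable {A : AbelianVariety ℂ} {C : Type} [Fintype C] (J : C → AbelianVariety ℂ)
  (π : ∀ c, A ⟶ J c) (ι : ∀ c, J c ⟶ A)

/-- `(f ≫ g)^* ξ = f^* (g^* ξ)` on `Hᵏ(–(ℂ); ℚ)`, for morphisms of complex schemes. [cite: MumfordAV1970, §1 (1)] -/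
theorem pull_comp_apply {X Y Z : SchemeOver ℂ} (f : X ⟶ Y) (g : Y ⟶ Z) (k : ℕ) (ξ : bettiCohomology Z k) :
    BettiUniverse.pull (f ≫ g) k ξ = BettiUniverse.pull f k (BettiUniverse.pull g k ξ) := by
  change (bettiCohomology.map (f ≫ g) k).hom ξ = _
  rw [bettiCohomology.map_comp, ModuleCat.hom_comp, LinearMap.comp_apply]

/-- `(Σ_c h_c)^* ξ = Σ_c h_c^* ξ` on `H¹` for homomorphisms of complex abelian varieties. [cite: MumfordAV1970, §1 (3)] -/
theorem pull_sum_hom_one_apply {B : AbelianVariety ℂ} (h : C → (A ⟶ B)) (ξ : bettiCohomology B.X 1) :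
    BettiUniverse.pull (∑ c, h c).hom.hom.hom 1 ξ = ∑ c, BettiUniverse.pull (h c).hom.hom.hom 1 ξ := by
  change (bettiCohomology.map (∑ c ∈ Finset.univ, h c).hom.hom.hom 1).hom ξ = _
  rw [bettiCohomology_map_sum_one, ModuleCat.hom_sum, LinearMap.sum_apply]

/-- `0^* = 0` on `H¹` for the zero homomorphism of complex abelian varieties. [cite: MumfordAV1970, §1 (3)] -/
theorem pull_zero_hom_one_apply {B : AbelianVariety ℂ} (ξ : bettiCohomology B.X 1) :
    BettiUniverse.pull (0 : A ⟶ B).hom.hom.hom 1 ξ = 0 := by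
  change (bettiCohomology.map (0 : A ⟶ B).hom.hom.hom 1).hom ξ = 0
  rw [bettiCohomology_map_zero_one, ModuleCat.hom_zero, LinearMap.zero_apply]

/-- **`H¹` of a split complex abelian variety**: for `π_c : A → J_c`, `ι_c : J_c → A` with `ι_c ≫ π_c = 𝟙`, `ι_c ≫ π_{c′} = 0` (`c ≠ c′`)
and `Σ_c π_c ≫ ι_c = 𝟙_A`, the map `ξ ↦ (ι_c^* ξ)_c : H¹(A(ℂ); ℚ) → Π_c H¹(J_c(ℂ); ℚ)` is bijective (inverse `(η_c) ↦ Σ_c π_c^* η_c`).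
[cite: MumfordAV1970, §1 (3) and §19] -/
theorem bijective_pi_pull_of_split (hιπ : ∀ c, ι c ≫ π c = 𝟙 _) (hιπ' : ∀ c c', c ≠ c' → ι c ≫ π c' = 0)
    (htot : ∑ c, π c ≫ ι c = 𝟙 A) :
    Function.Bijective (fun ξ : bettiCohomology A.X 1 => fun c => BettiUniverse.pull (ι c).hom.hom.hom 1 ξ) := by
  classical
  set Ψ : bettiCohomology A.X 1 → (∀ c, bettiCohomology (J c).X 1) :=
    fun ξ c => BettiUniverse.pull (ι c).hom.hom.hom 1 ξ with hΨ
  let Ψ' : (∀ c, bettiCohomology (J c).X 1) → bettiCohomology A.X 1 :=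
    fun η => ∑ c, BettiUniverse.pull (π c).hom.hom.hom 1 (η c)
  have hleft : Function.LeftInverse Ψ' Ψ := fun ξ => by
    change ∑ c, BettiUniverse.pull (π c).hom.hom.hom 1 (BettiUniverse.pull (ι c).hom.hom.hom 1 ξ) = ξ
    have h : ∀ c, BettiUniverse.pull (π c).hom.hom.hom 1 (BettiUniverse.pull (ι c).hom.hom.hom 1 ξ) =
        BettiUniverse.pull (π c ≫ ι c).hom.hom.hom 1 ξ := fun c => by
      rw [AbelianVariety.comp_hom]
      exact (pull_comp_apply _ _ 1 ξ).symm
    simp_rw [h]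
    rw [← pull_sum_hom_one_apply, htot, AbelianVariety.id_hom]
    change (bettiCohomology.map (𝟙 A.X) 1).hom ξ = ξ
    rw [bettiCohomology.map_id, ModuleCat.hom_id, LinearMap.id_apply]
  have hright : Function.RightInverse Ψ' Ψ := fun η => by
    funext c
    change BettiUniverse.pull (ι c).hom.hom.hom 1 (∑ c', BettiUniverse.pull (π c').hom.hom.hom 1 (η c')) = η c
    rw [map_sum]
    have h : ∀ c', BettiUniverse.pull (ι c).hom.hom.hom 1 (BettiUniverse.pull (π c').hom.hom.hom 1 (η c')) =
        BettiUniverse.pull (ι c ≫ π c').hom.hom.hom 1 (η c') := fun c' => by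
      rw [AbelianVariety.comp_hom]
      exact (pull_comp_apply _ _ 1 (η c')).symm
    simp_rw [h]
    rw [Finset.sum_eq_single c]
    · rw [hιπ, AbelianVariety.id_hom]
      change (bettiCohomology.map (𝟙 (J c).X) 1).hom (η c) = η c
      rw [bettiCohomology.map_id, ModuleCat.hom_id, LinearMap.id_apply]
    · intro c' _ hc'
      rw [hιπ' c c' (Ne.symm hc'), pull_zero_hom_one_apply]
    · intro h; exact absurd (Finset.mem_univ c) h
  exact ⟨hleft.injective, hright.surjective⟩

/-- **Block-diagonal bijectivity of a pull-back.**  Let `A` be split by `(π_c, ι_c)` as in `bijective_pi_pull_of_split`; let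
`f_c : E_c → X` be complex schemes over `X` with `ξ ↦ (f_c^* ξ)_c` bijective on `H¹` (a coproduct cofan:
`BettiCofan.bijective_pi_pull`); let `g_c : E_c → J_c` have `g_c^*` bijective on `H¹`; and let `αx : X → A` factor piecewise,
`f_c ≫ αx = g_c ≫ ι_c`.  Then `αx^* : H¹(A(ℂ); ℚ) → H¹(X(ℂ); ℚ)` is bijective — in the two product coordinates it is the diagonal
`(η_c) ↦ (g_c^* η_c)`.  (The shape of Liu's Lemma 2.4 (1) once `Alb_X ⊗ ℂ ≅ ∏_c J(E_c ⊗ ℂ)` compatibly with `α_X`.)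
[cite: Liu2021, Lemma 2.4 (1) proof (FJcycle.tex l. 1220–1228)] [cite: MumfordAV1970, §1 (3) and §19] -/
theorem bijective_pull_of_split_factorisation (hιπ : ∀ c, ι c ≫ π c = 𝟙 _)
    (hιπ' : ∀ c c', c ≠ c' → ι c ≫ π c' = 0) (htot : ∑ c, π c ≫ ι c = 𝟙 A)
    {X : SchemeOver ℂ} {E : C → SchemeOver ℂ} (f : ∀ c, E c ⟶ X)
    (hf : Function.Bijective (fun ξ : bettiCohomology X 1 => fun c => BettiUniverse.pull (f c) 1 ξ))
    (g : ∀ c, E c ⟶ (J c).X) (hg : ∀ c, Function.Bijective (BettiUniverse.pull (g c) 1))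
    (αx : X ⟶ A.X) (hfac : ∀ c, f c ≫ αx = g c ≫ (ι c).hom.hom.hom) :
    Function.Bijective (BettiUniverse.pull αx 1) := by
  have hΨ := bijective_pi_pull_of_split J π ι hιπ hιπ' htot
  -- the diagonal map
  have hD : Function.Bijective (fun η : (∀ c, bettiCohomology (J c).X 1) => fun c => BettiUniverse.pull (g c) 1 (η c)) :=
    ⟨fun η η' h => funext fun c => (hg c).1 (congr_fun h c),
      fun θ => ⟨fun c => Function.surjInv (hg c).2 (θ c), funext fun c => Function.surjInv_eq (hg c).2 (θ c)⟩⟩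
  -- `Θ ∘ αx^* = diag ∘ Ψ`
  have hkey : (fun ξ : bettiCohomology X 1 => fun c => BettiUniverse.pull (f c) 1 ξ) ∘ (BettiUniverse.pull αx 1) =
      (fun η : (∀ c, bettiCohomology (J c).X 1) => fun c => BettiUniverse.pull (g c) 1 (η c)) ∘
        (fun ξ : bettiCohomology A.X 1 => fun c => BettiUniverse.pull (ι c).hom.hom.hom 1 ξ) := by
    funext ξ c
    change BettiUniverse.pull (f c) 1 (BettiUniverse.pull αx 1 ξ) =
      BettiUniverse.pull (g c) 1 (BettiUniverse.pull (ι c).hom.hom.hom 1 ξ)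
    rw [← pull_comp_apply, ← pull_comp_apply, hfac c]
  have h := hD.comp hΨ
  rw [← hkey] at h
  refine ⟨h.1.of_comp, fun ζ => ?_⟩
  obtain ⟨ξ, hξ⟩ := h.2 (fun c => BettiUniverse.pull (f c) 1 ζ)
  exact ⟨ξ, hf.1 hξ⟩

end Split

end Literature.AlgebraicGeometry.HodgeTheory

end
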